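import Literature.NumberTheory.EllipticCurves.IwasawaSelmerDualUniquenessProofs
import Mathlib.Algebra.Module.CharacterModule
import HarnessLib

/-!
# Restriction of Pontryagin-dual data to a subgroup: the `Λ`-linear surjection
# `Hom(S, ℚ/ℤ) ↠ Hom(T, ℚ/ℤ)` for `T ↪ S` (abstract algebra over `Λ = ℤ_p⟦T⟧`)

HONEST FRAMING (BSD rank-`≤ 1` residual cell `b2b-bsdres`, home
`run/shared/lean/b2b/bsd-rank1-residual/`, unit `b2b-bsdres-eisenstein-p2`, class X2; research route,
no claim beyond stated classes): the cell deletes the COMBINATION-SHAPED residual classes of the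
rank-`≤ 1` BSD formula from PUBLISHED theorems only and TYPES the construction-shaped ones; this is
not "finishing BSD". THEOREMS ONLY (no definition, no named fact, nothing asserted). Pure algebra,
the plumbing of GV §2 p. 17 ("Regarding them as `Λ`-modules …") for NESTED Selmer-type groups.

## What

The tree's Pontryagin-dual data (`WeierstrassCurve.SelmerDualData`,
`GreenbergVatsal2000.NonPrimitiveDualData`, `GreenbergVatsal2000.DatumDualData`) all have the same
shape: a `p`-primary group `S` with an endomorphism `φ` (`= conj_γ`) such that `φ − 1` is locally
nilpotent (`IwasawaDual.IsLocNil`), a `Λ`-module `X`, a group isomorphism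
`toDual : X ≅ Hom(S, A)`, and the two identities `T ↦ φ − 1`, `C c ↦ (c mod p^k)`. This file
proves, once and abstractly (so that every such structure instantiates it by its fields):

* `toDual_smul_of_axioms` — **the `Λ`-action is forced**: `toDual (f • x) = f ⋆ toDual x` with `⋆`
  the canonical action `IsLocNil.smulFun` (the tree's `SelmerDualData.toDual_smul`, which is the
  case `S = Sel_E(K_∞)_p`, abstracted; proof adapted from
  `Literature/…/IwasawaSelmerDualUniquenessProofs.lean`);
* `smulFun_comp` — **naturality** of `smulFun` along an additive map `g : T → S` intertwining the
  endomorphisms (`φ_S ∘ g = g ∘ φ_T`): `(f ⋆ x) ∘ g = f ⋆ (x ∘ g)`;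
* `exists_restrict` — for dual data of `S` and of `T` and such a `g`: a `Λ`-LINEAR map
  `π : X_S → X_T` with `toDual_T (π x) = toDual_S x ∘ g` exists; `exists_restrict_surjective` — if
  `g` is injective and `A = ℚ/ℤ` then `π` is onto (characters extend: `ℚ/ℤ` is divisible,
  `CharacterModule.dual_surjective_of_injective`) and `π x = 0 ↔ toDual_S x ∘ g = 0`.

Used by the X2 lineage at a SPLIT multiplicative prime, where the classical Selmer group is the
STRICT datum group `S^{str}_A ≤ S_A` (GV pp. 14–15) and the dual of `S_A` surjects onto the dual of
`Sel_E(ℚ_∞)_p` with kernel the dual of the trivial-zero quotient `S_A/S^{str}_A`.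

References: R. Greenberg, LNM 1716 (1999) §1 p. 60 (the `Λ`-module structure); L. Washington,
*Cyclotomic Fields* §13.2; GV 2000 §2 p. 17.
-/

noncomputable section

open scoped Classical

namespace Summit.BirchSwinnertonDyer.Rank1Residual.X2.DualRestriction

open Literature.NumberTheory.EllipticCurves Literature.NumberTheory.EllipticCurves.IwasawaDual

/-! ## §1. The `Λ`-action of dual data is forced (abstract `toDual_smul`) -/

section Forced

variable {S : Type*} [AddCommGroup S] {A : Type*} [AddCommGroup A] {p : ℕ} [Fact p.Prime]
  (φ : AddMonoid.End S) (h : IsLocNil p (φ - 1))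
  {X : Type*} [AddCommGroup X] [Module (IwasawaAlgebra p) X] (toDual : X →+ (S →+ A))

/-- Induction carrier for `toDual_smul_of_axioms`: on `s` killed by `(φ − 1)^N`, the action read
through `toDual` is the canonical finite sum `IsLocNil.smulFun` (induction on `N`, peeling off the
constant term `f = T·g + C(a₀)`). Adapted from the tree proof
`SelmerDualData.toDual_smul_apply_of_pow_apply_eq_zero`. [cite: GreenbergLNM1716, §1 p. 60] -/
theorem toDual_smul_apply_of_pow_apply_eq_zero
    (hT : ∀ (x : X) (s : S), toDual ((PowerSeries.X : IwasawaAlgebra p) • x) s =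
      toDual x (φ s) - toDual x s)
    (hC : ∀ (c : ℤ_[p]) (x : X) (s : S) (k : ℕ), (p ^ k) • s = 0 →
      toDual (PowerSeries.C c • x) s = (PadicInt.toZModPow k c).val • toDual x s) (N : ℕ) :
    ∀ (s : S), ((φ - 1) ^ N) s = 0 → ∀ (f : IwasawaAlgebra p) (x : X),
      toDual (f • x) s = h.smulFun f (toDual x) s := by
  set ψ : AddMonoid.End S := φ - 1 with hψ
  induction N with
  | zero =>
    intro s hs f x
    rw [pow_zero, AddMonoid.End.one_apply] at hs
    rw [hs, map_zero, map_zero]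
  | succ N ih =>
    intro s hs f x
    obtain ⟨k, hk⟩ := h.torsion s
    have hψs : (ψ ^ N) (ψ s) = 0 := by
      rwa [pow_succ, AddMonoid.End.coe_mul, Function.comp_apply] at hs
    have hψeval : ∀ y : X, toDual y (ψ s) = toDual y (φ s) - toDual y s := fun y ↦ by
      rw [hψ, IwasawaDual.End_sub_apply, AddMonoid.End.one_apply, map_sub]
    set g : IwasawaAlgebra p := PowerSeries.mk fun n ↦ PowerSeries.coeff (n + 1) f
    set a : ℤ_[p] := PowerSeries.constantCoeff f
    have hf : f = PowerSeries.X * g + PowerSeries.C a := PowerSeries.eq_X_mul_shift_add_const f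
    have lhs : toDual (f • x) s =
        toDual (g • x) (ψ s) + (PadicInt.toZModPow k a).val • toDual x s := by
      conv_lhs => rw [hf]
      rw [add_smul, mul_smul, map_add, AddMonoidHom.add_apply, hT, hC a x s k hk, hψeval]
    have rhs : h.smulFun f (toDual x) s =
        h.smulFun g (toDual x) (ψ s) + (PadicInt.toZModPow k a).val • toDual x s := by
      conv_lhs => rw [hf]
      rw [h.smulFun_add_left, h.smulFun_mul_left, AddMonoidHom.add_apply, h.smulFun_X_apply,
        h.smulFun_C_apply a (toDual x) hk]
    rw [lhs, rhs, ih (ψ s) hψs g x]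

/-- **The `Λ`-action of any dual datum is forced**: if `toDual : X → Hom(S, A)` is additive and
satisfies `toDual (T·x) = toDual x ∘ φ − toDual x` and `toDual (C(c)·x) s = (c mod p^k) · toDual x s`
on `p^k`-torsion `s`, with `φ − 1` locally nilpotent on the `p`-primary group `S`, then for ALL
`f ∈ Λ`: `toDual (f • x) = f ⋆ toDual x` (`⋆ = IsLocNil.smulFun`). The tree's
`SelmerDualData.toDual_smul` is the instance `S = Sel_E(K_∞)_p`; the fields of `NonPrimitiveDualData`
and `DatumDualData` instantiate it equally. [cite: GreenbergLNM1716, §1 p. 60 (after Conj. 1.3)] -/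
theorem toDual_smul_of_axioms
    (hT : ∀ (x : X) (s : S), toDual ((PowerSeries.X : IwasawaAlgebra p) • x) s =
      toDual x (φ s) - toDual x s)
    (hC : ∀ (c : ℤ_[p]) (x : X) (s : S) (k : ℕ), (p ^ k) • s = 0 →
      toDual (PowerSeries.C c • x) s = (PadicInt.toZModPow k c).val • toDual x s)
    (f : IwasawaAlgebra p) (x : X) : toDual (f • x) = h.smulFun f (toDual x) := by
  ext s
  obtain ⟨N, hN⟩ := h.nil s
  exact toDual_smul_apply_of_pow_apply_eq_zero φ h toDual hT hC N s hN f x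

end Forced

/-! ## §2. Naturality of the canonical action along an intertwining map -/

section Naturality

variable {S T : Type*} [AddCommGroup S] [AddCommGroup T] {A : Type*} [AddCommGroup A] {p : ℕ}
  [Fact p.Prime] {ψS : AddMonoid.End S} {ψT : AddMonoid.End T}
  (hS : IsLocNil p ψS) (hT : IsLocNil p ψT) (g : T →+ S)

omit [Fact p.Prime] in
/-- Powers of intertwined endomorphisms are intertwined: `ψ_S^i (g t) = g (ψ_T^i t)`. [folklore] -/
theorem pow_apply_comm (hg : ∀ t, ψS (g t) = g (ψT t)) (i : ℕ) (t : T) :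
    (ψS ^ i) (g t) = g ((ψT ^ i) t) := by
  induction i with
  | zero => rw [pow_zero, pow_zero, AddMonoid.End.one_apply, AddMonoid.End.one_apply]
  | succ i ih =>
    rw [pow_succ', pow_succ', AddMonoid.End.coe_mul, AddMonoid.End.coe_mul, Function.comp_apply,
      Function.comp_apply, ← hg, ← ih]

/-- **Naturality of `smulFun`**: for `g : T → S` additive with `ψ_S ∘ g = g ∘ ψ_T` (both locally
nilpotent on `p`-primary groups), `(f ⋆ x) ∘ g = f ⋆ (x ∘ g)` for every `f ∈ Λ` and every
`x ∈ Hom(S, A)`: both sides are the finite sum `∑ (coeff_i f mod p^k) · x(g(ψ_T^i t))` for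
truncation parameters admissible for `t` (hence for `g t`). [cite: GreenbergLNM1716, §1 p. 60] -/
theorem smulFun_comp (hg : ∀ t, ψS (g t) = g (ψT t)) (f : IwasawaAlgebra p) (x : S →+ A) :
    (hS.smulFun f x).comp g = hT.smulFun f (x.comp g) := by
  ext t
  obtain ⟨N, hN⟩ := hT.nil t
  obtain ⟨k, hk⟩ := hT.torsion t
  have hN' : (ψS ^ N) (g t) = 0 := by rw [pow_apply_comm g hg, hN, map_zero]
  have hk' : p ^ k • g t = 0 := by rw [← map_nsmul, hk, map_zero]
  rw [AddMonoidHom.comp_apply, hS.smulFun_apply f x hN' hk', hT.smulFun_apply f _ hN hk, evalT_def,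
    evalT_def]
  refine Finset.sum_congr rfl fun i _ ↦ ?_
  rw [AddMonoidHom.comp_apply, pow_apply_comm g hg]

end Naturality

/-! ## §3. The restriction map between dual data along `g : T → S` -/

section Restrict

variable {S T : Type*} [AddCommGroup S] [AddCommGroup T] {A : Type*} [AddCommGroup A] {p : ℕ}
  [Fact p.Prime] (φS : AddMonoid.End S) (φT : AddMonoid.End T)
  {XS : Type*} [AddCommGroup XS] [Module (IwasawaAlgebra p) XS]
  {XT : Type*} [AddCommGroup XT] [Module (IwasawaAlgebra p) XT]
  (dS : XS →+ (S →+ A)) (dT : XT →+ (T →+ A))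

/-- **The `Λ`-linear restriction of dual data along an intertwining map.** Given dual data
`(X_S, toDual_S)` of `(S, φ_S)` and `(X_T, toDual_T)` of `(T, φ_T)` in the tree's shape (`toDual_T`
bijective) and `g : T → S` additive with `φ_S ∘ g = g ∘ φ_T`, there is a `Λ`-LINEAR `π : X_S → X_T`
with `toDual_T (π x) = toDual_S x ∘ g`: as a map of groups `π = toDual_T⁻¹ ∘ (− ∘ g) ∘ toDual_S`;
it is `Λ`-linear because both actions read through `toDual` are the canonical ones (§1) and the
canonical action is natural in `g` (§2). [cite: GreenbergLNM1716, §1 p. 60] -/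
theorem exists_restrict (hS : IsLocNil p (φS - 1)) (hT : IsLocNil p (φT - 1))
    (hbT : Function.Bijective dT)
    (hTS : ∀ (x : XS) (s : S), dS ((PowerSeries.X : IwasawaAlgebra p) • x) s = dS x (φS s) - dS x s)
    (hCS : ∀ (c : ℤ_[p]) (x : XS) (s : S) (k : ℕ), (p ^ k) • s = 0 →
      dS (PowerSeries.C c • x) s = (PadicInt.toZModPow k c).val • dS x s)
    (hTT : ∀ (y : XT) (t : T), dT ((PowerSeries.X : IwasawaAlgebra p) • y) t = dT y (φT t) - dT y t)
    (hCT : ∀ (c : ℤ_[p]) (y : XT) (t : T) (k : ℕ), (p ^ k) • t = 0 →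
      dT (PowerSeries.C c • y) t = (PadicInt.toZModPow k c).val • dT y t)
    (g : T →+ S) (hg : ∀ t, φS (g t) = g (φT t)) :
    ∃ π : XS →ₗ[IwasawaAlgebra p] XT, ∀ x, dT (π x) = (dS x).comp g := by
  let e : XT ≃+ (T →+ A) := AddEquiv.ofBijective dT hbT
  have he : ∀ χ : T →+ A, dT (e.symm χ) = χ := fun χ ↦ e.apply_symm_apply χ
  have hg' : ∀ t, (φS - 1) (g t) = g ((φT - 1) t) := fun t ↦ by
    rw [IwasawaDual.End_sub_apply, IwasawaDual.End_sub_apply, AddMonoid.End.one_apply,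
      AddMonoid.End.one_apply, map_sub, hg]
  refine ⟨{ toFun := fun x ↦ e.symm ((dS x).comp g)
            map_add' := fun x y ↦ by rw [map_add, AddMonoidHom.add_comp, map_add]
            map_smul' := fun f x ↦ ?_ }, fun x ↦ he _⟩
  apply hbT.1
  rw [RingHom.id_apply, he, toDual_smul_of_axioms φT hT dT hTT hCT f, he,
    toDual_smul_of_axioms φS hS dS hTS hCS f, smulFun_comp hS hT g hg']

/-- **Restriction to a SUBGROUP is onto, with kernel the annihilator** (`A = ℚ/ℤ`): for `g`
injective the `Λ`-linear restriction `π` of `exists_restrict` is surjective — every character of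
`T` extends to `S` because `ℚ/ℤ` is divisible (`CharacterModule.dual_surjective_of_injective`) —
and `π x = 0 ↔ toDual_S x ∘ g = 0`. So `X_T ≅ X_S / Hom(S/g(T), ℚ/ℤ)` as `Λ`-modules.
[cite: GreenbergLNM1716, §1 p. 60] -/
theorem exists_restrict_surjective (hS : IsLocNil p (φS - 1)) (hT : IsLocNil p (φT - 1))
    {XS : Type*} [AddCommGroup XS] [Module (IwasawaAlgebra p) XS]
    {XT : Type*} [AddCommGroup XT] [Module (IwasawaAlgebra p) XT]
    (dS : XS →+ (S →+ AddCircle (1 : ℚ))) (dT : XT →+ (T →+ AddCircle (1 : ℚ)))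
    (hbS : Function.Bijective dS) (hbT : Function.Bijective dT)
    (hTS : ∀ (x : XS) (s : S), dS ((PowerSeries.X : IwasawaAlgebra p) • x) s = dS x (φS s) - dS x s)
    (hCS : ∀ (c : ℤ_[p]) (x : XS) (s : S) (k : ℕ), (p ^ k) • s = 0 →
      dS (PowerSeries.C c • x) s = (PadicInt.toZModPow k c).val • dS x s)
    (hTT : ∀ (y : XT) (t : T), dT ((PowerSeries.X : IwasawaAlgebra p) • y) t = dT y (φT t) - dT y t)
    (hCT : ∀ (c : ℤ_[p]) (y : XT) (t : T) (k : ℕ), (p ^ k) • t = 0 →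
      dT (PowerSeries.C c • y) t = (PadicInt.toZModPow k c).val • dT y t)
    (g : T →+ S) (hg : ∀ t, φS (g t) = g (φT t)) (hinj : Function.Injective g) :
    ∃ π : XS →ₗ[IwasawaAlgebra p] XT, Function.Surjective π ∧
      (∀ x, dT (π x) = (dS x).comp g) ∧ ∀ x, π x = 0 ↔ (dS x).comp g = 0 := by
  obtain ⟨π, hπ⟩ := exists_restrict φS φT dS dT hS hT hbT hTS hCS hTT hCT g hg
  refine ⟨π, fun y ↦ ?_, hπ, fun x ↦ ?_⟩
  · -- extend the character `dT y` of `T` to `S`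
    obtain ⟨χ, hχ⟩ := CharacterModule.dual_surjective_of_injective g.toIntLinearMap hinj (dT y)
    obtain ⟨x, hx⟩ := hbS.2 χ
    refine ⟨x, hbT.1 ?_⟩
    rw [hπ, hx, ← hχ]
    rfl
  · rw [← hπ]
    exact ⟨fun h0 ↦ by rw [h0, map_zero], fun h0 ↦ hbT.1 (by rw [h0, map_zero])⟩

end Restrict

end Summit.BirchSwinnertonDyer.Rank1Residual.X2.DualRestriction

end
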